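import Summits.ResolutionOfSingularities.ResolutionOfSingularities.Theorems.WeightedInvariantContactCylinderStratumMap
import HarnessLib

/-!
# (c11-cyl): the cylinder construction `jCylinder ι₀ J` is compatible with essentially smooth local homomorphisms as soon as
# the top `ι₀`-stratum and the value of `J` at its generic point are — GENERIC COMBINATORS (abstract `ι₀`, abstract `J`)
# (door `HypersurfaceCentreConstruction`, stmt-ResolutionOfSingularities-19897; KEY `stub_localWeightedDropEFT4S`, P3 rung clause (c11)≤3,
# regime (A) «the top `ι₀`-stratum through the closed point is a curve» of res-L1-w43-stub-3's (o53) J-side for `Iota3.jFlatT`)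

Topic: `Summits/ResolutionOfSingularities/ResolutionOfSingularities/Theorems`. Helper for the door item
`HypersurfaceCentreConstruction` (stmt-ResolutionOfSingularities-19897, route `WeightedInvariant`), line `local-engine` of
res-L1-w43-plan-1 (L W4.3).  No new objects.  The `ι₀`-GENERIC form of p526917 (`topStratum_iotaOrd_map_of_eq`,
`jCylinder_iotaOrd_jContact_map_compatible`): for ANY invariant `ι₀` and ANY centre filtration `J` in the clause binder shapes,
along `φ : S → S'`:
(1) `topStratum_eq_of_preimage`: if the top `ι₀`-stratum of `S` is `V(P)` and that of `S'` is the preimage of that of `S` under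
`Spec φ` (the (strat)/(c11) base change for `ι₀`, supplied by the owner of `ι₀`), then the top `ι₀`-stratum of `S'` is `V(P S')`;
(2) `jCylinder_map_compatible_of_topStratum`: if the two top strata are `V(P)`, `V(P')` and `J` is compatible at the stratum
localisations (`(J (S'_{P'}) (φ f /1) m) ∩ S' = ((J (S_P) (f/1) m) ∩ S) S'`), then `jCylinder ι₀ J S' (φ f) m = (jCylinder ι₀ J S f m) S'`;
(3) `jCylinder_jContact_map_compatible_of_topStratum`: the instance `J = jContact` in regime P3a for an ABSTRACT `ι₀` whose top strata at
`S` and `S'` are the curve `V(x, g)` and its extension — `φ` essentially smooth local between regular local rings, `(x, g)` with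
independent differentials, the P2 data at `S_{(x,g)}` — by `cylinder_map_compatible` (p525507); and the same with the `S'`-stratum
hypothesis in preimage form.  These are the seams the (c11)≤3 J-side for `jFlatT = jCylinder iotaOrdEpsTau jFlatCoreE` cites in
regime (A) (there `jFlatCoreE = jContact` at the height-two stratum primes).

[OURS · L1 W4.3 · (o28)/(c11-cyl)]  Replaces the role of NO printed item; NOT a statement of the manuscript
[claim: Hironaka2017, status: under-review]. AI work, weaker than expert review.  Pure commutative algebra; no named facts.

## References

* H. Matsumura, *Commutative Ring Theory*, §22–§23 (flat and smooth base change), §28 (excellence). [Matsumura1987]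
* res-L1-w43-plan-1 IOTA3-DESIGN v1.3 §3/§9 (clause (c11)≤3; OURS, AI planning); res-L1-w43-stub-3 (o53) TAKING 2026-08-27T14:32:32Z.
-/

noncomputable section

open IsLocalRing Literature.AlgebraicGeometry.Resolution
open Summit.ResolutionOfSingularities.ResolutionOfSingularities.Cruxes.HypersurfaceCentreConstruction.LocalEngine

set_option linter.dupNamespace false -- mandated namespace of this single-conjunct summit

namespace Summit.ResolutionOfSingularities.ResolutionOfSingularities.Theorems

namespace ContactCylinder

/-! ## (1) Top strata under base change, for an abstract invariant -/

/-- **If the top `ι₀`-stratum of `S` is `V(P)` and the top `ι₀`-stratum of `S'` is its preimage under `Spec φ`, then the top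
`ι₀`-stratum of `S'` is `V(P S')`.** [folklore] -/
theorem topStratum_eq_of_preimage (ι₀ : (R : Type) → [CommRing R] → R → Ordinal.{0}) {S S' : Type} [CommRing S] [CommRing S']
    [Algebra S S'] (f : S) (f' : S') {P : Ideal S} (hE : topStratum ι₀ S f = {𝔮 | P ≤ 𝔮.asIdeal})
    (hpre : topStratum ι₀ S' f' = PrimeSpectrum.comap (algebraMap S S') ⁻¹' topStratum ι₀ S f) :
    topStratum ι₀ S' f' = {𝔮' | P.map (algebraMap S S') ≤ 𝔮'.asIdeal} := by
  ext 𝔮'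
  rw [hpre, Set.mem_preimage, hE, Set.mem_setOf_eq, Set.mem_setOf_eq, Ideal.map_le_iff_le_comap]
  exact Iff.rfl

/-- Pointwise form: the same from a pointwise base-change statement `𝔮' ∈ top stratum of S' ↔ 𝔮' ∩ S ∈ top stratum of S`. [folklore] -/
theorem topStratum_eq_of_forall_mem_iff (ι₀ : (R : Type) → [CommRing R] → R → Ordinal.{0}) {S S' : Type} [CommRing S]
    [CommRing S'] [Algebra S S'] (f : S) (f' : S') {P : Ideal S} (hE : topStratum ι₀ S f = {𝔮 | P ≤ 𝔮.asIdeal})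
    (hiff : ∀ 𝔮' : PrimeSpectrum S', 𝔮' ∈ topStratum ι₀ S' f' ↔ PrimeSpectrum.comap (algebraMap S S') 𝔮' ∈ topStratum ι₀ S f) :
    topStratum ι₀ S' f' = {𝔮' | P.map (algebraMap S S') ≤ 𝔮'.asIdeal} :=
  topStratum_eq_of_preimage ι₀ f f' hE (Set.ext fun 𝔮' => hiff 𝔮')

/-- Hence the generic prime of the top `ι₀`-stratum of `S'` is `P S'` (when prime). [folklore] -/
theorem topStratumPrime_eq_of_preimage (ι₀ : (R : Type) → [CommRing R] → R → Ordinal.{0}) {S S' : Type} [CommRing S]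
    [CommRing S'] [Algebra S S'] (f : S) (f' : S') {P : Ideal S} (hE : topStratum ι₀ S f = {𝔮 | P ≤ 𝔮.asIdeal})
    (hpre : topStratum ι₀ S' f' = PrimeSpectrum.comap (algebraMap S S') ⁻¹' topStratum ι₀ S f)
    [(P.map (algebraMap S S')).IsPrime] :
    topStratumPrime ι₀ S' f' = P.map (algebraMap S S') :=
  topStratumPrime_eq_of_topStratum_eq ι₀ S' f' (topStratum_eq_of_preimage ι₀ f f' hE hpre)

/-! ## (2) The generic (c11-cyl) combinator -/

/-- **(c11-cyl), GENERIC.**  `ι₀` any invariant, `J` any centre filtration (clause binder shapes), `φ : S → S'` any algebra map.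
If the top `ι₀`-stratum of `(S, f)` is `V(P)`, that of `(S', f')` is `V(P')` (`P, P'` prime), and `J` is compatible at the stratum
localisations — `(J (S'_{P'}) (f'/1) m) ∩ S' = ((J (S_P) (f/1) m) ∩ S) · S'` — then
`jCylinder ι₀ J S' f' m = (jCylinder ι₀ J S f m) · S'`. [folklore] -/
theorem jCylinder_map_compatible_of_topStratum (ι₀ : (R : Type) → [CommRing R] → R → Ordinal.{0})
    (J : (R : Type) → [CommRing R] → R → ℕ → Ideal R) {S S' : Type} [CommRing S] [CommRing S'] [Algebra S S']
    (f : S) (f' : S') {P : Ideal S} [P.IsPrime] {P' : Ideal S'} [P'.IsPrime]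
    (hE : topStratum ι₀ S f = {𝔮 | P ≤ 𝔮.asIdeal}) (hE' : topStratum ι₀ S' f' = {𝔮' | P' ≤ 𝔮'.asIdeal}) (m : ℕ)
    (hJ : (J (Localization.AtPrime P') (algebraMap S' (Localization.AtPrime P') f') m).comap
        (algebraMap S' (Localization.AtPrime P')) =
      ((J (Localization.AtPrime P) (algebraMap S (Localization.AtPrime P) f) m).comap
        (algebraMap S (Localization.AtPrime P))).map (algebraMap S S')) :
    jCylinder ι₀ J S' f' m = (jCylinder ι₀ J S f m).map (algebraMap S S') := by
  rw [jCylinder_eq_of_topStratum_eq ι₀ J S' f' m hE', jCylinder_eq_of_topStratum_eq ι₀ J S f m hE]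
  exact hJ

/-- The `cylinderAt` form of the same seam: `cylinderAt J S' P' f' m = (cylinderAt J S P f m) · S'` is literally the compatibility of
`J` at the stratum localisations. [folklore] -/
theorem cylinderAt_map_compatible_iff (J : (R : Type) → [CommRing R] → R → ℕ → Ideal R) {S S' : Type} [CommRing S]
    [CommRing S'] [Algebra S S'] (f : S) (f' : S') (P : Ideal S) [P.IsPrime] (P' : Ideal S') [P'.IsPrime] (m : ℕ) :
    cylinderAt J S' P' f' m = (cylinderAt J S P f m).map (algebraMap S S') ↔
      (J (Localization.AtPrime P') (algebraMap S' (Localization.AtPrime P') f') m).comap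
          (algebraMap S' (Localization.AtPrime P')) =
        ((J (Localization.AtPrime P) (algebraMap S (Localization.AtPrime P) f) m).comap
          (algebraMap S (Localization.AtPrime P))).map (algebraMap S S') := by
  rw [cylinderAt_def, cylinderAt_def]

/-! ## (3) The instance `J = jContact` in regime P3a, for an abstract invariant whose top stratum is the curve -/

section EssSmooth

variable (S S' : Type) [CommRing S] [IsRegularLocalRing S] [CommRing S'] [IsRegularLocalRing S'] [Algebra S S']
  [IsLocalHom (algebraMap S S')] [Algebra.FormallySmooth S S'] [Algebra.EssFiniteType S S']

/-- **(c11-cyl) for `jCylinder ι₀ jContact` in regime P3a, ABSTRACT `ι₀`.**  `φ : S → S'` an essentially smooth local homomorphism of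
regular local rings; `x, g ∈ 𝔪_S` with independent differentials, `𝔭 = (x, g)` prime; the P2 data at `S_𝔭` (`f/1 ≠ 0` not of monomial
type, `g/1` a contact parameter reaching the terminal level `b_max ≥ 1`); and an invariant `ι₀` whose top stratum is `V(𝔭)` at `(S, f)` and
`V(𝔭 S')` at `(S', φ f)`.  Then `jCylinder ι₀ jContact S' (φ f) m = (jCylinder ι₀ jContact S f m) · S'` for every `m`
(`cylinder_map_compatible`, p525507, through the generic combinator). [OURS · L1 W4.3 · (o28)/(c11-cyl)] -/
theorem jCylinder_jContact_map_compatible_of_topStratum (ι₀ : (R : Type) → [CommRing R] → R → Ordinal.{0})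
    (x g : S) (hxg : ∀ i, (![x, g] : Fin 2 → S) i ∈ maximalIdeal S)
    (hli : LinearIndependent (ResidueField S) (fun i => (maximalIdeal S).toCotangent ⟨(![x, g] : Fin 2 → S) i, hxg i⟩))
    [(Ideal.span {x, g}).IsPrime] (f : S)
    (hf0 : algebraMap S (Localization.AtPrime (Ideal.span {x, g})) f ≠ 0)
    (hnm : ¬ IsMonomialType (algebraMap S (Localization.AtPrime (Ideal.span {x, g})) f))
    (hreach : algebraMap S (Localization.AtPrime (Ideal.span {x, g})) f ∈
      contactFiltration (algebraMap S (Localization.AtPrime (Ideal.span {x, g})) g)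
        (bMax (algebraMap S (Localization.AtPrime (Ideal.span {x, g})) f))
        (bMax (algebraMap S (Localization.AtPrime (Ideal.span {x, g})) f) *
          (adicOrder (algebraMap S (Localization.AtPrime (Ideal.span {x, g})) f)).toNat))
    (hb : 1 ≤ bMax (algebraMap S (Localization.AtPrime (Ideal.span {x, g})) f))
    (hE : topStratum ι₀ S f = {𝔮 | Ideal.span {x, g} ≤ 𝔮.asIdeal})
    (hE' : topStratum ι₀ S' (algebraMap S S' f) = {𝔮' | Ideal.span {algebraMap S S' x, algebraMap S S' g} ≤ 𝔮'.asIdeal})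
    (m : ℕ) :
    jCylinder ι₀ jContact S' (algebraMap S S' f) m = (jCylinder ι₀ jContact S f m).map (algebraMap S S') := by
  haveI := isPrime_span_pair_map S S' x g hxg hli
  refine jCylinder_map_compatible_of_topStratum ι₀ jContact f (algebraMap S S' f) hE hE' m ?_
  rw [← IsScalarTower.algebraMap_apply S S' _ f]
  exact cylinder_map_compatible S S' x g hxg hli f hf0 hnm hreach hb m

/-- **The same with the `S'`-stratum hypothesis in PREIMAGE form** (`topStratum ι₀ S' (φ f) = (Spec φ)⁻¹ (topStratum ι₀ S f)` — the shape
in which the (strat)/(c11) base change for `ι₀` is delivered, e.g. `topStratum_iotaOrd_map` for `ι₀ = iotaOrd`: fed with it, this is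
p526917's `jCylinder_iotaOrd_jContact_map_compatible`). [OURS · L1 W4.3 · (o28)/(c11-cyl)] -/
theorem jCylinder_jContact_map_compatible_of_preimage (ι₀ : (R : Type) → [CommRing R] → R → Ordinal.{0})
    (x g : S) (hxg : ∀ i, (![x, g] : Fin 2 → S) i ∈ maximalIdeal S)
    (hli : LinearIndependent (ResidueField S) (fun i => (maximalIdeal S).toCotangent ⟨(![x, g] : Fin 2 → S) i, hxg i⟩))
    [(Ideal.span {x, g}).IsPrime] (f : S)
    (hf0 : algebraMap S (Localization.AtPrime (Ideal.span {x, g})) f ≠ 0)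
    (hnm : ¬ IsMonomialType (algebraMap S (Localization.AtPrime (Ideal.span {x, g})) f))
    (hreach : algebraMap S (Localization.AtPrime (Ideal.span {x, g})) f ∈
      contactFiltration (algebraMap S (Localization.AtPrime (Ideal.span {x, g})) g)
        (bMax (algebraMap S (Localization.AtPrime (Ideal.span {x, g})) f))
        (bMax (algebraMap S (Localization.AtPrime (Ideal.span {x, g})) f) *
          (adicOrder (algebraMap S (Localization.AtPrime (Ideal.span {x, g})) f)).toNat))
    (hb : 1 ≤ bMax (algebraMap S (Localization.AtPrime (Ideal.span {x, g})) f))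
    (hE : topStratum ι₀ S f = {𝔮 | Ideal.span {x, g} ≤ 𝔮.asIdeal})
    (hpre : topStratum ι₀ S' (algebraMap S S' f) = PrimeSpectrum.comap (algebraMap S S') ⁻¹' topStratum ι₀ S f) (m : ℕ) :
    jCylinder ι₀ jContact S' (algebraMap S S' f) m = (jCylinder ι₀ jContact S f m).map (algebraMap S S') := by
  refine jCylinder_jContact_map_compatible_of_topStratum S S' ι₀ x g hxg hli f hf0 hnm hreach hb hE ?_ m
  rw [topStratum_eq_of_preimage ι₀ f _ hE hpre, ← span_pair_map_eq_map S S' x g]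

end EssSmooth

end ContactCylinder

end Summit.ResolutionOfSingularities.ResolutionOfSingularities.Theorems

end
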